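import Literature.Topology.FourManifolds.NullImages
import Mathlib.LinearAlgebra.Dimension.Constructions
import Mathlib.Data.Fin.Tuple.Basic
import Mathlib.Algebra.BigOperators.Fin
import HarnessLib

/-!
# Generic parameters for finitely many affine conditions (easy Sard, tuple form)

Topic `Literature/Topology/FourManifolds`; general-position toolkit, companion of
`NullImages.lean` (whose `addHaar_setOf_exists_smul_add_smul_eq` is the case of two parameters).
Used by the tree's proof of Whitney's theorem *homotopic smooth embeddings `Mᵐ → Nⁿ`,
`n ≥ 2m + 2`, of a compact manifold are smoothly isotopic* (Milnor, *Lectures on the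
h-cobordism theorem* (1965), Thm. 8.4 and Remark; fact
`Literature.Topology.FourManifolds.Milnor1965_isSmoothlyIsotopic_of_homotopic`,
`HomotopicEmbeddingsIsotopic.lean`), where a family is perturbed in charts by terms
`∑ⱼ ℓⱼ • qⱼ` with `m + 1` vector parameters `qⱼ ∈ ℝⁿ`.  Everything here is proved:

* `Literature.Topology.FourManifolds.addHaar_setOf_exists_sum_smul_eq` — given coefficient
  functions `c j : X → ℝ` (`j : Fin (k + 1)`) and `Δ : X → V`, differentiable on `P ⊆ X`, with
  `dim X < dim V`, the set of tuples `q : Fin (k + 1) → V` for which `∑ⱼ c j p • q j = Δ p` for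
  some `p ∈ P` at which some `c j p ≠ 0` is null for every additive Haar measure: solving for
  `q j` where `c j p ≠ 0` exhibits it as the union of `k + 1` differentiable images of subsets of
  `X × (Fin k → V)`, a space of dimension `< (k + 1) dim V`
  (`addHaar_image_eq_zero_of_finrank_lt`, `NullImages.lean`).

## References

* J. Milnor, *Topology from the differentiable viewpoint* (1965), §§2–3 (Sard, case `n < p`).
  [MilnorTDV1965]
* M. W. Hirsch, *Differential Topology*, GTM 33 (1976), Ch. 3 §1 (Prop. 1.2), §2 (Thm. 2.5).
  [HirschDT1976]
* H. Whitney, *Differentiable manifolds*, Ann. of Math. (2) 37 (1936), 645–680, §§5–8.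
  [Whitney1936]
-/

open Set Function Module
open _root_.MeasureTheory _root_.MeasureTheory.Measure

noncomputable section

namespace Literature.Topology.FourManifolds

variable {X : Type*} [NormedAddCommGroup X] [NormedSpace ℝ X] [FiniteDimensional ℝ X]

/-- **Generic parameters for finitely many affine conditions.**  Let `c j : X → ℝ`
(`j : Fin (k + 1)`) and `Δ : X → V` be differentiable on `P ⊆ X`, with `dim X < dim V`.  Then the
set of `q : Fin (k + 1) → V` such that `∑ⱼ c j p • q j = Δ p` for some `p ∈ P` at which some
coefficient `c j p` is nonzero is null for every additive Haar measure on `Fin (k + 1) → V`: where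
`c j p ≠ 0` the condition reads `q j = (c j p)⁻¹ • (Δ p - ∑_{i ≠ j} c i p • q i)`, so the set is
covered by `k + 1` differentiable images of subsets of `X × (Fin k → V)`, and
`dim (X × (Fin k → V)) < dim (Fin (k + 1) → V)` (`addHaar_image_eq_zero_of_finrank_lt`).  This is
the form in which "general position" is used for families of maps of an `m`-manifold perturbed
by affine terms in chart coordinates (Whitney (1936), §§5–8; Hirsch (1976), Ch. 3, Thm. 2.5).
[folklore] -/
theorem addHaar_setOf_exists_sum_smul_eq {V : Type*} [NormedAddCommGroup V]
    [NormedSpace ℝ V] [FiniteDimensional ℝ V] [MeasurableSpace V] [BorelSpace V] {k : ℕ}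
    (μ : Measure (Fin (k + 1) → V)) [IsAddHaarMeasure μ] (hXV : finrank ℝ X < finrank ℝ V)
    {P : Set X} {c : Fin (k + 1) → X → ℝ} {Δ : X → V}
    (hc : ∀ j, DifferentiableOn ℝ (c j) P) (hΔ : DifferentiableOn ℝ Δ P) :
    μ {q : Fin (k + 1) → V | ∃ p ∈ P, (∃ j, c j p ≠ 0) ∧ ∑ j, c j p • q j = Δ p} = 0 := by
  have hdim : finrank ℝ (X × (Fin k → V)) < finrank ℝ (Fin (k + 1) → V) := by
    rw [finrank_prod, finrank_pi_fintype, finrank_pi_fintype]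
    simp only [Finset.sum_const, Finset.card_univ, Fintype.card_fin, smul_eq_mul]
    nlinarith
  -- the parametrisations, one for each coefficient solved for
  set D : Fin (k + 1) → Set (X × (Fin k → V)) := fun j => {z | z.1 ∈ P ∧ c j z.1 ≠ 0} with hD
  set Φ : Fin (k + 1) → X × (Fin k → V) → (Fin (k + 1) → V) := fun j z =>
    Fin.insertNth j ((c j z.1)⁻¹ • (Δ z.1 - ∑ i : Fin k, c (j.succAbove i) z.1 • z.2 i)) z.2
    with hΦ
  have hcf : ∀ j, DifferentiableOn ℝ (fun z : X × (Fin k → V) => c j z.1) (Prod.fst ⁻¹' P) :=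
    fun j => (hc j).comp differentiableOn_fst fun z hz => hz
  have hΔf : DifferentiableOn ℝ (fun z : X × (Fin k → V) => Δ z.1) (Prod.fst ⁻¹' P) :=
    hΔ.comp differentiableOn_fst fun z hz => hz
  have hDP : ∀ j, D j ⊆ Prod.fst ⁻¹' P := fun j z hz => hz.1
  have hcoord : ∀ i : Fin k, Differentiable ℝ fun z : X × (Fin k → V) => z.2 i := fun i => by
    have h := (differentiable_apply (𝕜 := ℝ) i).comp
      (differentiable_snd : Differentiable ℝ (Prod.snd : X × (Fin k → V) → Fin k → V))
    exact h
  have hsol : ∀ j, DifferentiableOn ℝ (fun z : X × (Fin k → V) =>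
      (c j z.1)⁻¹ • (Δ z.1 - ∑ i : Fin k, c (j.succAbove i) z.1 • z.2 i)) (D j) := by
    intro j
    refine DifferentiableOn.smul (((hcf j).mono (hDP j)).inv fun z hz => hz.2) ?_
    refine ((hΔf.mono (hDP j))).sub ?_
    refine DifferentiableOn.fun_sum fun i _ => ?_
    exact ((hcf (j.succAbove i)).mono (hDP j)).smul (hcoord i).differentiableOn
  have hΦd : ∀ j, DifferentiableOn ℝ (Φ j) (D j) := by
    intro j
    refine differentiableOn_pi.2 fun i => ?_
    rcases Fin.eq_self_or_eq_succAbove j i with rfl | ⟨i', rfl⟩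
    · simp only [hΦ, Fin.insertNth_apply_same]
      exact hsol i
    · simp only [hΦ, Fin.insertNth_apply_succAbove]
      exact (hcoord i').differentiableOn
  have hnull : ∀ j, μ (Φ j '' D j) = 0 := fun j =>
    addHaar_image_eq_zero_of_finrank_lt μ hdim (hΦd j)
  refine measure_mono_null ?_ ((measure_iUnion_null_iff (μ := μ)).2 hnull)
  rintro q ⟨p, hp, ⟨j, hj⟩, heq⟩
  refine mem_iUnion.2 ⟨j, ⟨(p, Fin.removeNth j q), ⟨hp, hj⟩, ?_⟩⟩
  -- `Φ j (p, removeNth j q) = q`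
  have hsplit : c j p • q j + ∑ i : Fin k, c (j.succAbove i) p • q (j.succAbove i) = Δ p := by
    rw [← heq, Fin.sum_univ_succAbove _ j]
  have hqj : (c j p)⁻¹ • (Δ p - ∑ i : Fin k, c (j.succAbove i) p • Fin.removeNth j q i) = q j := by
    simp only [Fin.removeNth_apply]
    rw [← hsplit, add_sub_cancel_right, smul_smul, inv_mul_cancel₀ hj, one_smul]
  simp only [hΦ]
  rw [hqj]
  exact Fin.insertNth_self_removeNth j q

end Literature.Topology.FourManifolds
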